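import Literature.Barriers.CriticalPhenomena.FiniteRangeDecompositionMassless
import Literature.Barriers.CriticalPhenomena.WeaklySAWGrandCanonical
import Literature.Probability.LatticeModels.SRWReturnFourier
import HarnessLib

/-!
# BBS 2015, §1.2 / §8.5: `C₀(0) = (-Δ_{ℤ^d})⁻¹_{0,0}` through the Fourier integral, and
# "`C(0) = Σ_{l≥0} C_{l+1;0,0}`" for the explicit finite-range decomposition at `m² = 0`

Companion file of `WeaklySAWFourDimLogCorrections.lean` (Bauerschmidt–Brydges–Slade, CMP 337
(2015), arXiv:1403.7422; there `CTWSAW.greenZero d = C₀(0) = ∫₀^∞ P(X(T) = 0)dT`, "the expected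
total time spent at the origin by the simple random walk", the constant of Theorem 1.2,
`a = 2C₀(0)`), of `WeaklySAWGrandCanonical.lean` (`greenZero_eq_tsum_prob`:
`C₀(0) = Σ_k p_k(0)/(2d)`, `d ≥ 3`), of `WeaklySAWCriticalNuFlowIteration.lean` (the printed §8.5,
"Proof of Theorem 1.2", proved modulo the flow with the HYPOTHESIS "`Σ_j C₁ j = G`" of `MuFlowAt`,
i.e. the display "Since `C(0) = Σ_{l=0}^∞ C_{l+1;0,0}`" — "all covariances have `m² = 0` in this
proof"), and of `FiniteRangeDecompositionMassless.lean` (the massless decomposition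
`Σ_{j≥1}C_{j;0,x}(0) = (-Δ_{ℤ^d})⁻¹_{x,0}` of the tree's explicit [Baue13a]/BBS decomposition
`LongRangePhi4.FRD.Gam`, `d ≥ 3`).

It identifies the three avatars of the massless Green function at the origin that occur in the
tree — the walk constant `greenZero d`, the Fourier resolvent `LongRangePhi4.resolventZd d 0 0 0 =
(2π)^{-d}∫_{[-π,π]^d}dk/λ(k)` and the lattice Green function `½·latticeGreen 0` — and concludes the
§8.5 display for the explicit decomposition:

* `abs_cos_eq_one_of_abs_avg_eq_one`, `countable_cos_two_mul_eq_one`, `ae_abs_avgCos_lt_one` —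
  `|d⁻¹Σ_j cos θ_j| < 1` for a.e. `θ` (the exceptional set lies in a null hyperplane union);
* **`hasSum_prob_zero_integral`** — `Σ_m p_m(0) = (2π)^{-d}∫_{[-π,π]^d} dθ/(1 - d⁻¹Σ_j cos θ_j)`
  (`d ≥ 3`; geometric series under the integral, dominated convergence with the bound
  `2/(1-μ(θ)) = 4d/λ(θ)`), from the tree's Fourier formula `SRW.prob_eq_integral` for `p_m(0)`;
* **`greenZero_eq_resolventZd`**, **`greenZero_eq_half_latticeGreen`** — `C₀(0) = (-Δ_{ℤ^d})⁻¹_{0,0}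
  = ½·latticeGreen 0` (`d ≥ 3`);
* **`hasSum_Gam_greenZero`** — **"`C(0) = Σ_{l=0}^∞ C_{l+1;0,0}`", PROVED** for the explicit
  decomposition at `m² = 0`: `HasSum (l ↦ Γ_{l+1}(0; m² = 0)) (greenZero d)` for `d ≥ 3`, `L ≥ 2`; in
  particular at `d = 4` (`hasSum_Gam_greenZero_four`), the input "`Σ_j C₁ j = G`" of
  `CTWSAW.MuFlowAt` with `G = greenZero 4` and `C₁ j = Γ_{j+1}(0;0)`.

Everything is proved; no definition and no named fact is introduced.
-/

noncomputable section

namespace Literature.Barriers.CriticalPhenomena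

open _root_.MeasureTheory Set Filter Finset
open scoped _root_.Topology Real BigOperators

namespace CTWSAW

open Literature.Probability.LatticeModels LongRangePhi4 LongRangePhi4.FRD

variable {d : ℕ}

/-! ### The symbol `μ(θ) = d⁻¹Σ_j cos θ_j` has modulus `< 1` almost everywhere -/

/-- If `|d⁻¹Σ_j cos θ_j| = 1` then every `|cos θ_i| = 1` (`d ≥ 1`). [folklore] -/
theorem abs_cos_eq_one_of_abs_avg_eq_one (hd : 1 ≤ d) {θ : Fin d → ℝ}
    (h : |(d : ℝ)⁻¹ * ∑ j, Real.cos (θ j)| = 1) (i : Fin d) : |Real.cos (θ i)| = 1 := by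
  have hd' : (0 : ℝ) < d := by exact_mod_cast hd
  by_contra hne
  have hlt : |Real.cos (θ i)| < 1 := lt_of_le_of_ne (Real.abs_cos_le_one _) hne
  have hsum : ∑ j, |Real.cos (θ j)| < ∑ _j : Fin d, (1 : ℝ) :=
    Finset.sum_lt_sum (fun j _ => Real.abs_cos_le_one _) ⟨i, Finset.mem_univ _, hlt⟩
  rw [Finset.sum_const, Finset.card_univ, Fintype.card_fin, nsmul_eq_mul, mul_one] at hsum
  have h1 : |∑ j, Real.cos (θ j)| < d := (Finset.abs_sum_le_sum_abs _ _).trans_lt hsum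
  rw [abs_mul, abs_of_pos (inv_pos.2 hd'), inv_mul_eq_div, div_eq_one_iff_eq hd'.ne'] at h
  linarith

/-- `|cos t| = 1 ⟹ cos 2t = 1`. [folklore] -/
theorem cos_two_mul_eq_one_of_abs_cos_eq_one {t : ℝ} (h : |Real.cos t| = 1) :
    Real.cos (2 * t) = 1 := by
  rw [Real.cos_two_mul]
  have : Real.cos t ^ 2 = 1 := by
    rw [← sq_abs, h, one_pow]
  linarith

/-- `{t | cos 2t = 1} ⊆ πℤ` is countable. [folklore] -/
theorem countable_cos_two_mul_eq_one : Set.Countable {t : ℝ | Real.cos (2 * t) = 1} := by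
  have hsub : {t : ℝ | Real.cos (2 * t) = 1} ⊆ Set.range fun n : ℤ => (n : ℝ) * π := by
    intro t ht
    obtain ⟨n, hn⟩ := (Real.cos_eq_one_iff _).1 ht
    exact ⟨n, by linarith⟩
  exact (Set.countable_range _).mono hsub

/-- **`|d⁻¹Σ_j cos θ_j| < 1` for a.e. `θ ∈ ℝ^d`** (`d ≥ 1`): the exceptional set lies in the null set
`{θ | cos 2θ₀ = 1}`. [folklore] -/
theorem ae_abs_avgCos_lt_one (hd : 1 ≤ d) :
    ∀ᵐ θ ∂(volume : Measure (Fin d → ℝ)), |(d : ℝ)⁻¹ * ∑ j, Real.cos (θ j)| < 1 := by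
  set i₀ : Fin d := ⟨0, hd⟩ with hi₀
  have hnull : (volume : Measure ℝ) {t : ℝ | Real.cos (2 * t) = 1} = 0 :=
    countable_cos_two_mul_eq_one.measure_zero volume
  have h0 : (volume : Measure (Fin d → ℝ))
      (Function.eval i₀ ⁻¹' {t : ℝ | Real.cos (2 * t) = 1}) = 0 := by
    rw [volume_pi]
    exact Measure.pi_eval_preimage_null (μ := fun _ : Fin d => (volume : Measure ℝ)) hnull
  refine (measure_eq_zero_iff_ae_notMem.1 h0).mono fun θ hθ => ?_
  have hle : |(d : ℝ)⁻¹ * ∑ j, Real.cos (θ j)| ≤ 1 := by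
    have hd' : (0 : ℝ) < d := by exact_mod_cast hd
    rw [abs_mul, abs_of_pos (inv_pos.2 hd'), inv_mul_le_iff₀ hd', mul_one]
    refine (Finset.abs_sum_le_sum_abs _ _).trans ?_
    calc ∑ j, |Real.cos (θ j)| ≤ ∑ _j : Fin d, (1 : ℝ) :=
          Finset.sum_le_sum fun j _ => Real.abs_cos_le_one _
      _ = d := by simp
  refine lt_of_le_of_ne hle fun heq => hθ ?_
  exact cos_two_mul_eq_one_of_abs_cos_eq_one (abs_cos_eq_one_of_abs_avg_eq_one hd heq i₀)

/-! ### `Σ_m p_m(0) = (2π)^{-d}∫ dθ/(1 - μ(θ))` (`d ≥ 3`) -/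

/-- `1 - d⁻¹Σ_j cos θ_j = λ(θ)/(2d)` (`λ(θ) = 2Σ_j(1 - cos θ_j)`, `d ≥ 1`). [folklore] -/
theorem one_sub_avgCos_eq (hd : 1 ≤ d) (θ : Fin d → ℝ) :
    1 - (d : ℝ)⁻¹ * ∑ j, Real.cos (θ j) = laplaceSymbol θ / (2 * d) := by
  have hd' : (d : ℝ) ≠ 0 := by exact_mod_cast (by omega : d ≠ 0)
  unfold laplaceSymbol dispersion
  rw [Finset.sum_sub_distrib, Finset.sum_const, Finset.card_univ, Fintype.card_fin, nsmul_eq_mul,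
    mul_one]
  field_simp

/-- `θ ↦ 1/(1 - μ(θ))` is integrable on `[-π,π]^d` for `d ≥ 3` (`= 2d/λ(θ)`). [cite: BauerschmidtBrydgesSlade2015LogCorr, §1.2 ("C₀(0) … finite for d > 2")] -/
theorem integrableOn_inv_one_sub_avgCos (hd : 3 ≤ d) :
    IntegrableOn (fun θ : Fin d → ℝ => 1 / (1 - (d : ℝ)⁻¹ * ∑ j, Real.cos (θ j))) (brillouin d) := by
  have e : (fun θ : Fin d → ℝ => 1 / (1 - (d : ℝ)⁻¹ * ∑ j, Real.cos (θ j))) =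
      fun θ => (2 * d) * (1 / laplaceSymbol θ) := by
    funext θ
    rw [one_sub_avgCos_eq (by omega) θ]
    have h3 : (3 : ℝ) ≤ d := by exact_mod_cast hd
    have hd' : (0 : ℝ) < 2 * d := by linarith
    field_simp
  rw [e]
  exact (integrableOn_inv_laplaceSymbol hd).const_mul _

/-- **`Σ_m p_m(0) = (2π)^{-d}∫_{[-π,π]^d} dθ/(1 - d⁻¹Σ_j cos θ_j)`** for `d ≥ 3`: the geometric series
under the Fourier integral `p_m(0) = (2π)^{-d}∫μ(θ)^m dθ` (`SRW.prob_eq_integral`), by dominated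
convergence (`|Σ_{m<M}μ^m| = |1-μ^M|/(1-μ) ≤ 2/(1-μ)`, integrable for `d ≥ 3`; `|μ| < 1` a.e.).
[cite: BauerschmidtBrydgesSlade2015LogCorr, §1.2 (C₀(0), "the expected total time spent at the origin by the simple random walk", finite for d > 2)] -/
theorem hasSum_prob_zero_integral (hd : 3 ≤ d) :
    HasSum (fun m : ℕ => SRW.prob d m 0)
      (((2 * π) ^ d : ℝ)⁻¹ * ∫ θ in brillouin d, 1 / (1 - (d : ℝ)⁻¹ * ∑ j, Real.cos (θ j))) := by
  have hd1 : 1 ≤ d := by omega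
  set μf : (Fin d → ℝ) → ℝ := fun θ => (d : ℝ)⁻¹ * ∑ j, Real.cos (θ j) with hμf
  have hcont : Continuous μf := by rw [hμf]; fun_prop
  have hint := integrableOn_inv_one_sub_avgCos hd
  have hae : ∀ᵐ θ ∂(volume : Measure (Fin d → ℝ)).restrict (brillouin d), |μf θ| < 1 :=
    ae_restrict_of_ae (ae_abs_avgCos_lt_one hd1)
  -- dominated convergence for the partial sums of the geometric series
  have hT : Tendsto (fun M : ℕ => ∫ θ in brillouin d, ∑ m ∈ range M, μf θ ^ m) atTop
      (𝓝 (∫ θ in brillouin d, 1 / (1 - μf θ))) := by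
    refine tendsto_integral_of_dominated_convergence (fun θ => 2 * (1 / (1 - μf θ)))
      (fun M => (continuous_finsetSum _ fun m _ => hcont.pow m).aestronglyMeasurable)
      (hint.const_mul 2) (fun M => ?_) ?_
    · filter_upwards [hae] with θ hθ
      have hμ1 : μf θ < 1 := (abs_lt.1 hθ).2
      have hpos : 0 < 1 - μf θ := by linarith
      have hne : μf θ ≠ 1 := hμ1.ne
      rw [Real.norm_eq_abs, geom_sum_eq hne, abs_div,
        show |μf θ - 1| = 1 - μf θ by rw [abs_sub_comm, abs_of_pos hpos], div_le_iff₀ hpos]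
      have h1 : |μf θ ^ M - 1| ≤ 2 := by
        calc |μf θ ^ M - 1| ≤ |μf θ ^ M| + |(1 : ℝ)| := abs_sub _ _
          _ ≤ 1 + 1 := by
              rw [abs_one, abs_pow]
              exact add_le_add (pow_le_one₀ (abs_nonneg _) hθ.le) le_rfl
          _ = 2 := by norm_num
      calc |μf θ ^ M - 1| ≤ 2 := h1
        _ = 2 * (1 / (1 - μf θ)) * (1 - μf θ) := by field_simp
    · filter_upwards [hae] with θ hθ
      have h := (hasSum_geometric_of_abs_lt_one hθ).tendsto_sum_nat
      rwa [← one_div] at h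
  -- the partial sums are `(2π)^d Σ_{m<M} p_m(0)`
  have hI : ∀ M : ℕ, ∫ θ in brillouin d, ∑ m ∈ range M, μf θ ^ m =
      (2 * π) ^ d * ∑ m ∈ range M, SRW.prob d m 0 := by
    intro M
    rw [integral_finsetSum (range M) (f := fun m θ => μf θ ^ m) fun m _ =>
      LongRangePhi4.integrableOn_brillouin_of_continuous (hcont.pow m),
      Finset.mul_sum]
    refine Finset.sum_congr rfl fun m _ => ?_
    rw [SRW.prob_eq_integral (by omega) m]
    have hπ : ((2 * π) ^ d : ℝ) ≠ 0 := by positivity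
    rw [← mul_assoc, mul_inv_cancel₀ hπ, one_mul]
  have hπ : ((2 * π) ^ d : ℝ) ≠ 0 := by positivity
  rw [hasSum_iff_tendsto_nat_of_nonneg (fun m => SRW.prob_nonneg m 0)]
  have e : (fun M : ℕ => ∑ m ∈ range M, SRW.prob d m 0) =
      fun M => ((2 * π) ^ d : ℝ)⁻¹ * ∫ θ in brillouin d, ∑ m ∈ range M, μf θ ^ m := by
    funext M
    rw [hI M, ← mul_assoc, inv_mul_cancel₀ hπ, one_mul]
  rw [e]
  exact hT.const_mul _

/-! ### `C₀(0) = (-Δ_{ℤ^d})⁻¹_{0,0} = ½·latticeGreen 0` -/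

/-- **`C₀(0) = (-Δ_{ℤ^d})⁻¹_{0,0}`** (`d ≥ 3`): the walk constant `greenZero d = Σ_kp_k(0)/(2d)` equals the
massless Fourier resolvent `(2π)^{-d}∫dk/λ(k)` (`LongRangePhi4.resolventZd d 0 0 0`).
[cite: BauerschmidtBrydgesSlade2015LogCorr, §1.2 (C₀(0)) and §8.5 ("C(0)", all covariances at m² = 0)] -/
theorem greenZero_eq_resolventZd (hd : 3 ≤ d) : greenZero d = resolventZd d 0 0 0 := by
  have hd1 : 1 ≤ d := by omega
  have h3 : (3 : ℝ) ≤ d := by exact_mod_cast hd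
  have hd' : (0 : ℝ) < 2 * d := by linarith
  rw [greenZero_eq_tsum_prob hd, (hasSum_prob_zero_integral hd).tsum_eq]
  unfold resolventZd
  simp only [Pi.zero_apply, Int.cast_zero, sub_self, mul_zero, Finset.sum_const_zero,
    Real.cos_zero, add_zero]
  have e : ∀ θ : Fin d → ℝ, 1 / (1 - (d : ℝ)⁻¹ * ∑ j, Real.cos (θ j)) =
      (2 * d) * (1 / laplaceSymbol θ) := by
    intro θ
    rw [one_sub_avgCos_eq hd1 θ]
    field_simp
  simp_rw [e, integral_const_mul]
  field_simp

/-- **`C₀(0) = ½·latticeGreen 0`** (`d ≥ 3`): the walk constant is half the tree's lattice Green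
function at the origin (`latticeGreen` has the symbol `ε = λ/2`). [folklore] -/
theorem greenZero_eq_half_latticeGreen (hd : 3 ≤ d) : greenZero d = latticeGreen (0 : Site d) / 2 := by
  rw [greenZero_eq_resolventZd hd, resolventZd_zero_eq_half_latticeGreen]

/-! ### "`C(0) = Σ_{l=0}^∞ C_{l+1;0,0}`" for the explicit decomposition at `m² = 0` -/

/-- **BBS 2015, §8.5: "`C(0) = Σ_{l=0}^∞ C_{l+1;0,0}`", PROVED** for the explicit finite-range
decomposition at `m² = 0` (`d ≥ 3`, scale ratio `L ≥ 2`): the massless terms `C_{l+1}(0) =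
LongRangePhi4.FRD.Gam d L 0 (l+1)` at the origin sum to `C₀(0) = greenZero d`.
[cite: BauerschmidtBrydgesSlade2015LogCorr, §8.5 ("Since C(0) = Σ_{l=0}^∞ C_{l+1;0,0}")] -/
theorem hasSum_Gam_greenZero (hd : 3 ≤ d) {L : ℝ} (hL : 2 ≤ L) :
    HasSum (fun l : ℕ => Gam d L 0 (l + 1) 0) (greenZero d) := by
  rw [greenZero_eq_resolventZd hd]
  exact hasSum_Gam_massless hd hL 0

/-- The `d = 4` instance: `Σ_{l≥0} C_{l+1;0,0}(0) = C₀(0)` with `C₀(0) = greenZero 4` — the input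
"`Σ_j C₁ j = G`" (with `G = greenZero 4`, `C₁ j = Γ_{j+1}(0; m² = 0)`) of the §8.5 hypothesis
structure `CTWSAW.MuFlowAt` of `WeaklySAWCriticalNuFlowIteration.lean`.
[cite: BauerschmidtBrydgesSlade2015LogCorr, §8.5 ("Since C(0) = Σ_{l=0}^∞ C_{l+1;0,0}", d = 4)] -/
theorem hasSum_Gam_greenZero_four {L : ℝ} (hL : 2 ≤ L) :
    HasSum (fun l : ℕ => Gam 4 L 0 (l + 1) 0) (greenZero 4) :=
  hasSum_Gam_greenZero (by norm_num) hL

end CTWSAW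

end Literature.Barriers.CriticalPhenomena
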